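import Literature.AlgebraicTopology.SingularHomology.NoncompactManifoldProofs
import Literature.AlgebraicTopology.SingularHomology.RelativeCapProduct
import Mathlib.Algebra.Exact.Basic
import HarnessLib

/-!
# The relative Mayer–Vietoris sequence of local homology `H_*(X | A)` for closed `A`, `B`

A. Hatcher, *Algebraic Topology* (2002), §2.2 p. 152 (relative Mayer–Vietoris) and §3.3,
proof of Lemma 3.27 (the sequence `… → Hᵢ(X | A ∪ B) → Hᵢ(X | A) ⊕ Hᵢ(X | B) → Hᵢ(X | A ∩ B)
→ Hᵢ₋₁(X | A ∪ B) → …`); H. Miller, *Lectures on Algebraic Topology* (2020), Thm. 36.2 (the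
homology Mayer–Vietoris ladder of `H_q(X | ·)`).

For closed `A`, `B ⊆ X` and the concrete local homology `H_i(X | A) = H_i(C(X)/C(X ∖ A))`
(`clocalHomology`, `LocalHomology.lean`), with `S = C(X ∖ A)`, `T = C(X ∖ B)`: the short exact
sequence `0 → C/(S ⊓ T) → C/S ⊞ C/T → C/(S ⊔ T) → 0` (`Subcomplex.mvQuot`), the equality
`S ⊓ T = C(X ∖ (A ∪ B))` and the quasi-isomorphism `C/(S ⊔ T) → C/C(X ∖ (A ∩ B))` (small chains,
`isIso_homologyMap_incl_sup_awaySub`) give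

* `clocalHomology.mvRes`, `mvDiff`, `mvδ` — the three maps, as `R`-linear maps
  `H_i(X | A ∪ B) → H_i(X | A) × H_i(X | B) → H_i(X | A ∩ B) → H_{i-1}(X | A ∪ B)`,
  `α ↦ (α|, α|)`, `(β, γ) ↦ β| - γ|`;
* `clocalHomology.mvδ_relCls` — **the connecting map on representatives**: if `z` is an
  `(i+1)`-chain with `∂z = a + b`, `a` avoiding `A` and `b` avoiding `B`, then
  `∂[z] = [b] ∈ H_i(X | A ∪ B)`;
* `clocalHomology.mv_exact₂`, `mv_exact₃`, `mv_exact₁` — exactness at the three spots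
  (`Function.Exact`).

Everything is proved; no named facts.

## References

* A. Hatcher, *Algebraic Topology*, CUP 2002, §2.2 p. 152, §3.3 Lemma 3.27. [HatcherAT2002]
* H. Miller, *Lectures on Algebraic Topology*, World Scientific 2020, Thm. 36.2. [Miller2020]
-/

noncomputable section

-- as in `SingularChainsConcrete`: chains of the concrete complex are `Finsupp`s up to unfolding
set_option backward.isDefEq.respectTransparency false

open CategoryTheory Limits

universe u v w

namespace Literature.AlgebraicTopology.SingularHomology

namespace clocalHomology

variable (R : Type v) [CommRing R] (M : Type v) [AddCommGroup M] [Module R M]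
variable {X : Type u} [TopologicalSpace X]

/-! ### The maps -/

/-- **`H_i(X | A ∪ B) → H_i(X | A) × H_i(X | B)`, `α ↦ (α|A, α|B)`** (Hatcher 2002, §2.2 p. 152).
[cite: HatcherAT2002, §2.2 p. 152] -/
def mvRes (A B : Set X) (i : ℕ) :
    clocalHomology R M X (A ∪ B) i →ₗ[R] clocalHomology R M X A i × clocalHomology R M X B i :=
  LinearMap.prod (res R M X Set.subset_union_left i).hom (res R M X Set.subset_union_right i).hom

/-- **`H_i(X | A) × H_i(X | B) → H_i(X | A ∩ B)`, `(β, γ) ↦ β| - γ|`** (Hatcher 2002, §2.2 p. 152).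
[cite: HatcherAT2002, §2.2 p. 152] -/
def mvDiff (A B : Set X) (i : ℕ) :
    clocalHomology R M X A i × clocalHomology R M X B i →ₗ[R] clocalHomology R M X (A ∩ B) i :=
  (res R M X Set.inter_subset_left i).hom ∘ₗ LinearMap.fst R _ _ -
    (res R M X Set.inter_subset_right i).hom ∘ₗ LinearMap.snd R _ _

/-- `mvRes` unfolded. [folklore] -/
@[simp] lemma mvRes_apply (A B : Set X) (i : ℕ) (α : clocalHomology R M X (A ∪ B) i) :
    mvRes R M A B i α = (res R M X Set.subset_union_left i α, res R M X Set.subset_union_right i α) :=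
  rfl

/-- `mvDiff` unfolded. [folklore] -/
@[simp] lemma mvDiff_apply (A B : Set X) (i : ℕ) (β : clocalHomology R M X A i)
    (γ : clocalHomology R M X B i) :
    mvDiff R M A B i (β, γ) =
      res R M X Set.inter_subset_left i β - res R M X Set.inter_subset_right i γ :=
  rfl

variable {A B : Set X}

/-- `H_i(C/(C(X ∖ A) + C(X ∖ B))) → H_i(X | A ∩ B)` is an isomorphism for closed `A`, `B`
(small chains; Hatcher 2002, Prop. 2.21). [cite: HatcherAT2002, Prop. 2.21] -/
lemma isIso_homologyMap_quotientMap_sup (hA : IsClosed A) (hB : IsClosed B) (i : ℕ) :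
    IsIso (HomologicalComplex.homologyMap (Subcomplex.quotientMap (sup_awaySub_le R M A B)) i) :=
  Subcomplex.isIso_homologyMap_quotientMap _ (isIso_homologyMap_incl_sup_awaySub R M hA hB) i

/-- The identification `H_i(C/(C(X ∖ A) + C(X ∖ B))) ≃ H_i(X | A ∩ B)` (closed `A`, `B`). [folklore] -/
def supQuotEquiv (hA : IsClosed A) (hB : IsClosed B) (i : ℕ) :
    (awaySub R M X A ⊔ awaySub R M X B).quotient.homology i ≃ₗ[R] clocalHomology R M X (A ∩ B) i :=
  haveI := isIso_homologyMap_quotientMap_sup R M hA hB i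
  (asIso (HomologicalComplex.homologyMap
    (Subcomplex.quotientMap (sup_awaySub_le R M A B)) i)).toLinearEquiv

/-- `supQuotEquiv` unfolded. [folklore] -/
lemma supQuotEquiv_apply (hA : IsClosed A) (hB : IsClosed B) (i : ℕ) (x) :
    supQuotEquiv R M hA hB i x =
      HomologicalComplex.homologyMap (Subcomplex.quotientMap (sup_awaySub_le R M A B)) i x :=
  rfl

/-- `K/S ⟶ K/S` along `S ≤ S` is the identity. [folklore] -/
lemma _root_.Literature.AlgebraicTopology.SingularHomology.Subcomplex.quotientMap_rfl
    {ι : Type*} {c : ComplexShape ι} {K : HomologicalComplex (ModuleCat.{w} R) c} (S : Subcomplex K) :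
    Subcomplex.quotientMap (le_refl S) = 𝟙 _ :=
  Subcomplex.quotMap_id S _

/-- The identification `H_i(C/(C(X ∖ A) ⊓ C(X ∖ B))) ≃ H_i(X | A ∪ B)` (an equality of
subcomplexes, `awaySub_union`). [folklore] -/
def infQuotEquiv (A B : Set X) (i : ℕ) :
    (awaySub R M X A ⊓ awaySub R M X B).quotient.homology i ≃ₗ[R] clocalHomology R M X (A ∪ B) i :=
  LinearEquiv.ofLinear
    (HomologicalComplex.homologyMap (Subcomplex.quotientMap (awaySub_union R M A B).ge) i).hom
    (HomologicalComplex.homologyMap (Subcomplex.quotientMap (awaySub_union R M A B).le) i).hom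
    (by
      rw [← ModuleCat.hom_comp, ← HomologicalComplex.homologyMap_comp,
        Subcomplex.quotientMap_comp_quotientMap]
      change (HomologicalComplex.homologyMap (Subcomplex.quotientMap (le_refl _)) i).hom = _
      rw [Subcomplex.quotientMap_rfl, HomologicalComplex.homologyMap_id]
      rfl)
    (by
      rw [← ModuleCat.hom_comp, ← HomologicalComplex.homologyMap_comp,
        Subcomplex.quotientMap_comp_quotientMap]
      change (HomologicalComplex.homologyMap (Subcomplex.quotientMap (le_refl _)) i).hom = _
      rw [Subcomplex.quotientMap_rfl, HomologicalComplex.homologyMap_id]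
      rfl)

/-- `infQuotEquiv` unfolded. [folklore] -/
lemma infQuotEquiv_apply (A B : Set X) (i : ℕ) (x) :
    infQuotEquiv R M A B i x =
      HomologicalComplex.homologyMap (Subcomplex.quotientMap (awaySub_union R M A B).ge) i x :=
  rfl

/-- **The Mayer–Vietoris connecting map `∂ : H_{i+1}(X | A ∩ B) → H_i(X | A ∪ B)`** for closed
`A`, `B` (Hatcher 2002, §2.2 p. 152): the connecting map of `0 → C/(S ⊓ T) → C/S ⊞ C/T →
C/(S ⊔ T) → 0` transported along the two identifications. [cite: HatcherAT2002, §2.2 p. 152] -/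
def mvδ (hA : IsClosed A) (hB : IsClosed B) (i : ℕ) :
    clocalHomology R M X (A ∩ B) (i + 1) →ₗ[R] clocalHomology R M X (A ∪ B) i :=
  (infQuotEquiv R M A B i).toLinearMap ∘ₗ
    ((Subcomplex.mvQuot_shortExact (awaySub R M X A) (awaySub R M X B)).δ (i + 1) i rfl).hom ∘ₗ
      (supQuotEquiv R M hA hB (i + 1)).symm.toLinearMap

/-! ### The connecting map on representatives -/

/-- **`∂[z] = [b]`**: if `z` is an `(i+1)`-chain whose boundary splits as `∂z = a + b` with `a`
avoiding `A` and `b` avoiding `B` (so that `z` is a relative cycle of `(X, X ∖ (A ∩ B))` and `b` a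
relative cycle of `(X, X ∖ (A ∪ B))`), then the Mayer–Vietoris connecting map sends `[z]` to
`[b]` (Hatcher 2002, §2.2 p. 150, the description of `∂` in Mayer–Vietoris sequences, relative
form p. 152). [cite: HatcherAT2002, §2.2 pp. 150, 152] -/
theorem mvδ_relCls (hA : IsClosed A) (hB : IsClosed B) (i : ℕ)
    (z : (csingularChainComplex R M X).X (i + 1)) (b : (csingularChainComplex R M X).X i)
    (hb : b ∈ awaySub R M X B i)
    (ha : (csingularChainComplex R M X).d (i + 1) i z - b ∈ awaySub R M X A i)
    (hz : (csingularChainComplex R M X).d (i + 1) ((ComplexShape.down ℕ).next (i + 1)) z ∈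
      awaySub R M X (A ∩ B) ((ComplexShape.down ℕ).next (i + 1)))
    (hb' : (csingularChainComplex R M X).d i ((ComplexShape.down ℕ).next i) b ∈
      awaySub R M X (A ∪ B) ((ComplexShape.down ℕ).next i)) :
    mvδ R M hA hB i ((awaySub R M X (A ∩ B)).relCls z hz) = (awaySub R M X (A ∪ B)).relCls b hb' := by
  have hdzb : (csingularChainComplex R M X).d (i + 1) i z =
      ((csingularChainComplex R M X).d (i + 1) i z - b) + b := (sub_add_cancel _ _).symm
  -- `z` is a relative cycle modulo `S ⊔ T`
  have hzST : (csingularChainComplex R M X).d (i + 1) ((ComplexShape.down ℕ).next (i + 1)) z ∈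
      (awaySub R M X A ⊔ awaySub R M X B) ((ComplexShape.down ℕ).next (i + 1)) := by
    rw [ChainComplex.next_nat_succ, hdzb]
    exact Submodule.add_mem_sup ha hb
  -- transport the class of `z` back to `H(C/(S ⊔ T))`
  have h1 : (supQuotEquiv R M hA hB (i + 1)).symm ((awaySub R M X (A ∩ B)).relCls z hz) =
      (awaySub R M X A ⊔ awaySub R M X B).relCls z hzST := by
    rw [LinearEquiv.symm_apply_eq, supQuotEquiv_apply, Subcomplex.homologyMap_quotientMap_relCls]
  -- the snake lemma on representatives
  have hb_cyc : (csingularChainComplex R M X).d i ((ComplexShape.down ℕ).next i) b ∈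
      (awaySub R M X A ⊓ awaySub R M X B) ((ComplexShape.down ℕ).next i) := by
    rw [← awaySub_union]
    exact hb'
  have h2 : (Subcomplex.mvQuot_shortExact (awaySub R M X A) (awaySub R M X B)).δ (i + 1) i rfl
      ((awaySub R M X A ⊔ awaySub R M X B).relCls z hzST) =
        (awaySub R M X A ⊓ awaySub R M X B).relCls b hb_cyc := by
    have key := (Subcomplex.mvQuot_shortExact (awaySub R M X A) (awaySub R M X B)).δ_apply (i + 1) i rfl
      ((awaySub R M X A ⊔ awaySub R M X B).π.f (i + 1) z)
      (by
        change (awaySub R M X A ⊔ awaySub R M X B).quotient.d (i + 1) i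
          ((awaySub R M X A ⊔ awaySub R M X B).π.f (i + 1) z) = 0
        rw [Subcomplex.quotient_d_π_f, Subcomplex.π_f_eq_zero_iff, hdzb]
        exact Submodule.add_mem_sup ha hb)
      ((biprod.inl : _ ⟶ (awaySub R M X A).quotient ⊞ (awaySub R M X B).quotient).f (i + 1)
        ((awaySub R M X A).π.f (i + 1) z))
      (by
        change (Subcomplex.mvQuotG (awaySub R M X A) (awaySub R M X B)).f (i + 1)
          ((biprod.inl : _ ⟶ (awaySub R M X A).quotient ⊞ (awaySub R M X B).quotient).f (i + 1)
            ((awaySub R M X A).π.f (i + 1) z)) = _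
        rw [Subcomplex.mvQuotG_inl, Subcomplex.quotientMap_f_π_f])
      ((awaySub R M X A ⊓ awaySub R M X B).π.f i b)
      (by
        change (Subcomplex.mvQuotF (awaySub R M X A) (awaySub R M X B)).f i
            ((awaySub R M X A ⊓ awaySub R M X B).π.f i b) =
          ((awaySub R M X A).quotient ⊞ (awaySub R M X B).quotient).d (i + 1) i
            ((biprod.inl : _ ⟶ (awaySub R M X A).quotient ⊞ (awaySub R M X B).quotient).f (i + 1)
              ((awaySub R M X A).π.f (i + 1) z))
        have hcomm : ∀ y, ((awaySub R M X A).quotient ⊞ (awaySub R M X B).quotient).d (i + 1) i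
            ((biprod.inl : _ ⟶ (awaySub R M X A).quotient ⊞ (awaySub R M X B).quotient).f (i + 1) y) =
            (biprod.inl : _ ⟶ (awaySub R M X A).quotient ⊞ (awaySub R M X B).quotient).f i
              ((awaySub R M X A).quotient.d (i + 1) i y) := fun y => by
          rw [← ModuleCat.comp_apply,
            (biprod.inl : _ ⟶ (awaySub R M X A).quotient ⊞ (awaySub R M X B).quotient).comm,
            ModuleCat.comp_apply]
        rw [Subcomplex.mvQuotF_apply, Subcomplex.quotientMap_f_π_f,
          Subcomplex.quotientMap_f_π_f, ((awaySub R M X B).π_f_eq_zero_iff i b).mpr hb, map_zero,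
          add_zero, hcomm, Subcomplex.quotient_d_π_f]
        congr 1
        rw [Subcomplex.π_f_eq_π_f_iff]
        have e : b - (csingularChainComplex R M X).d (i + 1) i z =
            -((csingularChainComplex R M X).d (i + 1) i z - b) := (neg_sub _ _).symm
        rw [e]
        exact Submodule.neg_mem _ ha)
      ((ComplexShape.down ℕ).next i) rfl
    rw [Subcomplex.relCls, Subcomplex.relCls,
      homologyCls_eq_homologyπ_cyclesMk _ _ i (ChainComplex.next_nat_succ i),
      homologyCls_eq_homologyπ_cyclesMk _ _ ((ComplexShape.down ℕ).next i) rfl]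
    exact key
  -- assemble
  change infQuotEquiv R M A B i
    ((Subcomplex.mvQuot_shortExact (awaySub R M X A) (awaySub R M X B)).δ (i + 1) i rfl
      ((supQuotEquiv R M hA hB (i + 1)).symm ((awaySub R M X (A ∩ B)).relCls z hz))) = _
  rw [h1, h2, infQuotEquiv_apply, Subcomplex.homologyMap_quotientMap_relCls]

/-! ### Exactness -/

section Exactness

variable (A B) in
/-- `H_i(C/S ⊞ C/T) → H_i(X | A) × H_i(X | B)`, `w ↦ (H(fst) w, H(snd) w)`. [folklore] -/
def biprodQuotHom (i : ℕ) :
    ((awaySub R M X A).quotient ⊞ (awaySub R M X B).quotient).homology i →ₗ[R]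
      clocalHomology R M X A i × clocalHomology R M X B i :=
  LinearMap.prod
    (HomologicalComplex.homologyMap
      (biprod.fst : (awaySub R M X A).quotient ⊞ (awaySub R M X B).quotient ⟶ _) i).hom
    (HomologicalComplex.homologyMap
      (biprod.snd : (awaySub R M X A).quotient ⊞ (awaySub R M X B).quotient ⟶ _) i).hom

/-- `w = H(inl) (H(fst) w) + H(inr) (H(snd) w)` on `H_i(C/S ⊞ C/T)`. [folklore] -/
lemma biprodQuot_decomp (i : ℕ)
    (w : ((awaySub R M X A).quotient ⊞ (awaySub R M X B).quotient).homology i) :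
    HomologicalComplex.homologyMap
        (biprod.inl : _ ⟶ (awaySub R M X A).quotient ⊞ (awaySub R M X B).quotient) i
        (HomologicalComplex.homologyMap
          (biprod.fst : (awaySub R M X A).quotient ⊞ (awaySub R M X B).quotient ⟶ _) i w) +
      HomologicalComplex.homologyMap
        (biprod.inr : _ ⟶ (awaySub R M X A).quotient ⊞ (awaySub R M X B).quotient) i
        (HomologicalComplex.homologyMap
          (biprod.snd : (awaySub R M X A).quotient ⊞ (awaySub R M X B).quotient ⟶ _) i w) = w := by
  have h0 : HomologicalComplex.homologyMap
      (𝟙 ((awaySub R M X A).quotient ⊞ (awaySub R M X B).quotient)) i w = w := by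
    rw [HomologicalComplex.homologyMap_id]
    rfl
  conv_rhs => rw [← h0, ← biprod.total]
  rw [HomologicalComplex.homologyMap_add, HomologicalComplex.homologyMap_comp,
    HomologicalComplex.homologyMap_comp]
  rfl

variable (A B) in
/-- The identification `H_i(C/S ⊞ C/T) ≃ H_i(X | A) × H_i(X | B)`. [folklore] -/
def biprodQuotEquiv (i : ℕ) :
    ((awaySub R M X A).quotient ⊞ (awaySub R M X B).quotient).homology i ≃ₗ[R]
      clocalHomology R M X A i × clocalHomology R M X B i :=
  LinearEquiv.ofBijective (biprodQuotHom R M A B i) (by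
    constructor
    · intro w w' h
      rw [← biprodQuot_decomp R M i w, ← biprodQuot_decomp R M i w']
      have h1 := congrArg Prod.fst h
      have h2 := congrArg Prod.snd h
      change HomologicalComplex.homologyMap (biprod.fst : (awaySub R M X A).quotient ⊞ (awaySub R M X B).quotient ⟶ _) i w =
        HomologicalComplex.homologyMap (biprod.fst : (awaySub R M X A).quotient ⊞ (awaySub R M X B).quotient ⟶ _) i w' at h1
      change HomologicalComplex.homologyMap (biprod.snd : (awaySub R M X A).quotient ⊞ (awaySub R M X B).quotient ⟶ _) i w =
        HomologicalComplex.homologyMap (biprod.snd : (awaySub R M X A).quotient ⊞ (awaySub R M X B).quotient ⟶ _) i w' at h2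
      rw [h1, h2]
    · rintro ⟨a, b⟩
      refine ⟨HomologicalComplex.homologyMap
          (biprod.inl : _ ⟶ (awaySub R M X A).quotient ⊞ (awaySub R M X B).quotient) i a +
        HomologicalComplex.homologyMap
          (biprod.inr : _ ⟶ (awaySub R M X A).quotient ⊞ (awaySub R M X B).quotient) i b,
        Prod.ext ?_ ?_⟩
      · change HomologicalComplex.homologyMap (biprod.fst : (awaySub R M X A).quotient ⊞ (awaySub R M X B).quotient ⟶ _) i (_ + _) = a
        rw [map_add]
        change (HomologicalComplex.homologyMap (biprod.inl : _ ⟶ (awaySub R M X A).quotient ⊞ (awaySub R M X B).quotient) i ≫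
            HomologicalComplex.homologyMap (biprod.fst : (awaySub R M X A).quotient ⊞ (awaySub R M X B).quotient ⟶ _) i) a +
          (HomologicalComplex.homologyMap (biprod.inr : _ ⟶ (awaySub R M X A).quotient ⊞ (awaySub R M X B).quotient) i ≫
            HomologicalComplex.homologyMap (biprod.fst : (awaySub R M X A).quotient ⊞ (awaySub R M X B).quotient ⟶ _) i) b = a
        rw [← HomologicalComplex.homologyMap_comp, ← HomologicalComplex.homologyMap_comp,
          biprod.inl_fst, biprod.inr_fst, HomologicalComplex.homologyMap_id,
          HomologicalComplex.homologyMap_zero]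
        simp
      · change HomologicalComplex.homologyMap (biprod.snd : (awaySub R M X A).quotient ⊞ (awaySub R M X B).quotient ⟶ _) i (_ + _) = b
        rw [map_add]
        change (HomologicalComplex.homologyMap (biprod.inl : _ ⟶ (awaySub R M X A).quotient ⊞ (awaySub R M X B).quotient) i ≫
            HomologicalComplex.homologyMap (biprod.snd : (awaySub R M X A).quotient ⊞ (awaySub R M X B).quotient ⟶ _) i) a +
          (HomologicalComplex.homologyMap (biprod.inr : _ ⟶ (awaySub R M X A).quotient ⊞ (awaySub R M X B).quotient) i ≫
            HomologicalComplex.homologyMap (biprod.snd : (awaySub R M X A).quotient ⊞ (awaySub R M X B).quotient ⟶ _) i) b = b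
        rw [← HomologicalComplex.homologyMap_comp, ← HomologicalComplex.homologyMap_comp,
          biprod.inl_snd, biprod.inr_snd, HomologicalComplex.homologyMap_id,
          HomologicalComplex.homologyMap_zero]
        simp)

/-- `biprodQuotEquiv` unfolded. [folklore] -/
lemma biprodQuotEquiv_apply (i : ℕ) (w) :
    biprodQuotEquiv R M A B i w =
      (HomologicalComplex.homologyMap
        (biprod.fst : (awaySub R M X A).quotient ⊞ (awaySub R M X B).quotient ⟶ _) i w,
       HomologicalComplex.homologyMap
        (biprod.snd : (awaySub R M X A).quotient ⊞ (awaySub R M X B).quotient ⟶ _) i w) :=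
  rfl

/-- First square: `mvRes ∘ φ₁ = φ₂ ∘ H(f)`. [folklore] -/
lemma mvRes_comp_infQuotEquiv (i : ℕ) :
    mvRes R M A B i ∘ₗ (infQuotEquiv R M A B i).toLinearMap =
      (biprodQuotEquiv R M A B i).toLinearMap ∘ₗ
        (HomologicalComplex.homologyMap
          (Subcomplex.mvQuotF (awaySub R M X A) (awaySub R M X B)) i).hom := by
  apply LinearMap.ext
  intro y
  simp only [LinearMap.comp_apply, LinearEquiv.coe_toLinearMap, infQuotEquiv_apply,
    biprodQuotEquiv_apply, mvRes_apply]
  congr 1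
  · change (HomologicalComplex.homologyMap (Subcomplex.quotientMap _) i ≫ res R M X _ i) y =
      (HomologicalComplex.homologyMap (Subcomplex.mvQuotF (awaySub R M X A) (awaySub R M X B)) i ≫
        HomologicalComplex.homologyMap biprod.fst i) y
    rw [res_eq, ← HomologicalComplex.homologyMap_comp, ← HomologicalComplex.homologyMap_comp,
      Subcomplex.quotientMap_comp_quotientMap, biprod.lift_fst]
  · change (HomologicalComplex.homologyMap (Subcomplex.quotientMap _) i ≫ res R M X _ i) y =
      (HomologicalComplex.homologyMap (Subcomplex.mvQuotF (awaySub R M X A) (awaySub R M X B)) i ≫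
        HomologicalComplex.homologyMap biprod.snd i) y
    rw [res_eq, ← HomologicalComplex.homologyMap_comp, ← HomologicalComplex.homologyMap_comp,
      Subcomplex.quotientMap_comp_quotientMap, biprod.lift_snd]

/-- Second square: `mvDiff ∘ φ₂ = φ₃ ∘ H(g)`. [folklore] -/
lemma mvDiff_comp_biprodQuotEquiv (hA : IsClosed A) (hB : IsClosed B) (i : ℕ) :
    mvDiff R M A B i ∘ₗ (biprodQuotEquiv R M A B i).toLinearMap =
      (supQuotEquiv R M hA hB i).toLinearMap ∘ₗ
        (HomologicalComplex.homologyMap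
          (Subcomplex.mvQuotG (awaySub R M X A) (awaySub R M X B)) i).hom := by
  apply LinearMap.ext
  intro w
  simp only [LinearMap.comp_apply, LinearEquiv.coe_toLinearMap, supQuotEquiv_apply,
    biprodQuotEquiv_apply, mvDiff_apply]
  conv_rhs => rw [← biprodQuot_decomp R M i w]
  rw [map_add, map_add]
  have e1 : ∀ a, HomologicalComplex.homologyMap (Subcomplex.quotientMap (sup_awaySub_le R M A B)) i
      (HomologicalComplex.homologyMap (Subcomplex.mvQuotG (awaySub R M X A) (awaySub R M X B)) i
        (HomologicalComplex.homologyMap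
          (biprod.inl : _ ⟶ (awaySub R M X A).quotient ⊞ (awaySub R M X B).quotient) i a)) =
      res R M X Set.inter_subset_left i a := fun a => by
    change (HomologicalComplex.homologyMap biprod.inl i ≫
      HomologicalComplex.homologyMap (Subcomplex.mvQuotG (awaySub R M X A) (awaySub R M X B)) i ≫
        HomologicalComplex.homologyMap (Subcomplex.quotientMap _) i) a = _
    rw [← HomologicalComplex.homologyMap_comp, ← HomologicalComplex.homologyMap_comp,
      biprod.inl_desc_assoc, Subcomplex.quotientMap_comp_quotientMap, res_eq]
  have e2 : ∀ b, HomologicalComplex.homologyMap (Subcomplex.quotientMap (sup_awaySub_le R M A B)) i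
      (HomologicalComplex.homologyMap (Subcomplex.mvQuotG (awaySub R M X A) (awaySub R M X B)) i
        (HomologicalComplex.homologyMap
          (biprod.inr : _ ⟶ (awaySub R M X A).quotient ⊞ (awaySub R M X B).quotient) i b)) =
      -res R M X Set.inter_subset_right i b := fun b => by
    change (HomologicalComplex.homologyMap biprod.inr i ≫
      HomologicalComplex.homologyMap (Subcomplex.mvQuotG (awaySub R M X A) (awaySub R M X B)) i ≫
        HomologicalComplex.homologyMap (Subcomplex.quotientMap _) i) b = _
    rw [← HomologicalComplex.homologyMap_comp, ← HomologicalComplex.homologyMap_comp,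
      biprod.inr_desc_assoc, Preadditive.neg_comp,
      Subcomplex.quotientMap_comp_quotientMap, HomologicalComplex.homologyMap_neg, res_eq]
    rfl
  rw [e1, e2, sub_eq_add_neg]

/-- Third square: `mvδ ∘ φ₃ = φ₁ ∘ δ`. [folklore] -/
lemma mvδ_comp_supQuotEquiv (hA : IsClosed A) (hB : IsClosed B) (i : ℕ) :
    mvδ R M hA hB i ∘ₗ (supQuotEquiv R M hA hB (i + 1)).toLinearMap =
      (infQuotEquiv R M A B i).toLinearMap ∘ₗ
        ((Subcomplex.mvQuot_shortExact (awaySub R M X A) (awaySub R M X B)).δ (i + 1) i rfl).hom := by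
  apply LinearMap.ext
  intro w
  change infQuotEquiv R M A B i
    ((Subcomplex.mvQuot_shortExact (awaySub R M X A) (awaySub R M X B)).δ (i + 1) i rfl
      ((supQuotEquiv R M hA hB (i + 1)).symm (supQuotEquiv R M hA hB (i + 1) w))) = _
  rw [LinearEquiv.symm_apply_apply]
  rfl

/-- **Exactness at `H_i(X | A) × H_i(X | B)`** (Hatcher 2002, §2.2 p. 152). [cite: HatcherAT2002, §2.2 p. 152] -/
theorem mv_exact₂ (hA : IsClosed A) (hB : IsClosed B) (i : ℕ) :
    Function.Exact (mvRes R M A B i) (mvDiff R M A B i) := by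
  have h := (ShortComplex.ShortExact.moduleCat_exact_iff_function_exact _).mp
    ((Subcomplex.mvQuot_shortExact (awaySub R M X A) (awaySub R M X B)).homology_exact₂ i)
  exact Function.Exact.of_ladder_linearEquiv_of_exact (mvRes_comp_infQuotEquiv R M i)
    (mvDiff_comp_biprodQuotEquiv R M hA hB i) h

/-- **Exactness at `H_{i+1}(X | A ∩ B)`** (Hatcher 2002, §2.2 p. 152). [cite: HatcherAT2002, §2.2 p. 152] -/
theorem mv_exact₃ (hA : IsClosed A) (hB : IsClosed B) (i : ℕ) :
    Function.Exact (mvDiff R M A B (i + 1)) (mvδ R M hA hB i) := by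
  have h := (ShortComplex.ShortExact.moduleCat_exact_iff_function_exact _).mp
    ((Subcomplex.mvQuot_shortExact (awaySub R M X A) (awaySub R M X B)).homology_exact₃ (i + 1) i rfl)
  exact Function.Exact.of_ladder_linearEquiv_of_exact (mvDiff_comp_biprodQuotEquiv R M hA hB (i + 1))
    (mvδ_comp_supQuotEquiv R M hA hB i) h

/-- **Exactness at `H_i(X | A ∪ B)`** (Hatcher 2002, §2.2 p. 152). [cite: HatcherAT2002, §2.2 p. 152] -/
theorem mv_exact₁ (hA : IsClosed A) (hB : IsClosed B) (i : ℕ) :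
    Function.Exact (mvδ R M hA hB i) (mvRes R M A B i) := by
  have h := (ShortComplex.ShortExact.moduleCat_exact_iff_function_exact _).mp
    ((Subcomplex.mvQuot_shortExact (awaySub R M X A) (awaySub R M X B)).homology_exact₁ (i + 1) i rfl)
  exact Function.Exact.of_ladder_linearEquiv_of_exact (mvδ_comp_supQuotEquiv R M hA hB i)
    (mvRes_comp_infQuotEquiv R M i) h

end Exactness

end clocalHomology

end Literature.AlgebraicTopology.SingularHomology
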